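import Summits.HubbardSuperconductivity.HubbardSuperconductivity.Theses.LiebTwin

/-!
# Birth skeleton (BC3) for crux `TwinOnsiteCondensation` — stmt-HubbardSuperconductivity-15258
(route `LiebTwin`, route-HubbardSuperconductivity-LiebTwin, rank 2; sub-problem `HubbardSuperconductivity`)

Planner `planner-skel-stmt-HubbardSuperconductivity-15258-0`, 2026-08-17 (mode skeleton-register); reshaped by the
line lead `prover-line-stmt-HubbardSuperconductivity-15258-c1-0`, 2026-08-17 (rev 2: the two stub theorems now
STATE THEIR SIGNATURES EXPLICITLY in tree vocabulary — no skeleton-local name in a stub type — so that each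
stub can be landed verbatim from a `Theorems/` helper file importing only `Literature.*`; statements unchanged).
Published as `Cruxes/TwinOnsiteCondensation/Lines/birth.lean`.

THE CRUX (K2 of the route, rev 1, by name `…Theses.LiebTwin.TwinOnsiteCondensation`): at some box point
`(U, δ) ∈ (0,4] × [1/10,3/10]` there are `c > 0`, `L₀` such that for every even `L ≥ L₀` and EVERY
normalised `(N_L, S^z = 0)`-sector ground state `φ` of the repulsive `hubbardTorus 2 L 1 U`
(`N_L = 2n`, `n = ⌊(1-δ)L²/2⌋`), the TWIN `φ̃ := liebVec n |liebW n φ|` (`|W| = (WᴴW)^{1/2} = CFC.abs W`,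
the canonical purification of the one-species `n`-body density matrix `WᴴW`) is an on-site `s`-wave
condensate: `c·L⁴ ≤ F_s(φ̃) := Re⟨φ̃, (pairField sWave L)ᴴ (pairField sWave L) φ̃⟩`.

THE LINE = the route's own foreseen first cut of K2 (route header, TWO-LAYER PLAN:
"TwinOnsiteCondensation ⇐ TwinIsAttractiveLike → AttractiveOnsiteLRO"): K2 = (the attractive-`U` sibling's
own `s`-wave LRO statement, stub A) + (K2 RELATIVE to the sibling, stub T). By Lieb's Theorem 1 (tree:
`lieb_attractive_holds`, `LiebThm1.isLiebSystem_hubbard`, `IsLiebSystem.exists_posDef_eq_smul`) the sector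
ground state `ψ` of the ATTRACTIVE model is unique up to a phase and has a semidefinite Lieb matrix, so `ψ` IS
its own twin: stub A is literally "K2 at `U' < 0`", and stub T is where the sign of `U` enters.

* `stub_attractiveOnsiteLRO` — THE SIBLING'S OPEN CORE (size: open problem). For every `U' < 0` and every
  `δ ∈ [1/10,3/10]` there are `c > 0`, `L₀` with `c·L⁴ ≤ F_s(ψ)` for every even `L ≥ L₀` and every normalised
  `(2n, 0)`-sector ground state `ψ` of `hubbardTorus 2 L 1 U'`. Sources: LiebPRL1989 (Thm 1), Tian1992,
  doi:10.1103/physrevlett.72.1280, Tian2004, KuboKishi1990, Yang1962.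
* `stub_twinDominatesAttractive` — K2 RELATIVE TO THE SIBLING (size XL, load-bearing). At some box point
  `(U, δ)` there are `U' < 0`, `θ > 0`, `L₀` such that for every even `L ≥ L₀` and every normalised repulsive
  sector ground state `φ` there is a normalised attractive sector ground state `ψ` of `hubbardTorus 2 L 1 U'`
  in the SAME sector with `θ·F_s(ψ) ≤ F_s(φ̃)`. Strictly weaker than K2 (K2 + Yang's cap, tree
  `re_expect_pairField_conjTranspose_mul_le_yang`, give it). Provable structural core (landed separately as
  `--supports` helpers by the lead): the twin pair-order identity
  `½F_s(liebVec n V) = n(L²-n+1)·‖V‖² - ½Σ_{x,y}‖[V, c†_x c_y]‖²` for Hermitian Lieb matrices `V`, i.e. K2 is a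
  commutator-defect bound on `|W|` against the one-body hopping algebra. Sources: LiebPRL1989 (eq. (3)),
  Tian2004, BachLiebSolovej1994, QinEtAl2020, Yang1962.
* `TwinOnsiteCondensation_of : stub T-sig → stub A-sig → TwinOnsiteCondensation` — the composition, sorry-free:
  `θc·L⁴ ≤ θ·F_s(ψ) ≤ F_s(φ̃)` beyond `max L₀ L₁`; hypotheses spelled `__Registered.stub_X` (`rfl`-aliases of
  the stub statements keyed by the stub names); conclusion = the route decl BY NAME.

Disproof used: none exists for this crux on 2026-08-17 (`ledger crux ls`: Lines/birth.{lean,md}, PICKED.md; no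
`Disproof.lean`, no landed `Theorems/TwinOnsiteCondensation/Negative/*`); `ledger negatives --problem
HubbardSuperconductivity` = {stmt-1180, stmt-1314}, neither about pair order of Hubbard ground states or twins.
Degenerate-witness pass (planner, re-read): sectors `(n,n)` with `2n ≤ L²` are nonempty, so neither stub is
vacuous; `F_s ≤ 2n(L²-n+1)` (Yang) keeps both inequalities non-trivial; the `∃ ψ` of stub T cannot be met by
`ψ = 0` (normalisation) and is equivalent to `∀ ψ` by Lieb's uniqueness.

LANDED HELPERS (`--supports`, all in `Summits/…/Theorems/`, namespace `…Theorems` / `…Theorems.LiebTwinTwin`):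
* `LiebTwinTwinOnsiteCondensationAttractiveTwin.lean` (p147858): `attractiveTwin_eq_smul` — for `U' < 0` every sector ground state
  is its own twin up to a phase; `re_expect_pairField_sWave_attractiveTwin` (`F_s(ψ̃) = F_s(ψ)`); GS ⟷ positive ground matrix.
* `LiebTwinTwinOnsiteCondensationTwinPairOrderIdentity.lean` (p148986): `expect_pairField_sWave_twin_eq` —
  `F_s(φ̃) = 2n(L²-n+1)‖φ‖² - Σ_{x,y} Tr([|W|,B_{yx}]ᴴ[|W|,B_{yx}])`, `B_{yx} = configHop n y x`; `le_re_expect_pairField_sWave_twin_iff`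
  (K2 ⟺ a commutation-defect bound on `|W|` against the one-body hopping algebra); `re_expect_pairField_sWave_twin_le` (Yang cap).
* `LiebTwinTwinOnsiteCondensationCutExact.lean` (p149371): `twinDominatesAttractive_of_twinOnsiteCondensation` — K2 ⟹ stub T
  (`U' = -1`, `θ = c/2`), so given stub A, stub T ⟺ K2 (the cut is exact); Yang's cap `F_s ≤ 2n(L²-n+1)‖ψ‖²`.
* `LiebTwinTwinOnsiteCondensationRectificationMonotone.lean` (proposing): `re_expect_pairField_sWave_le_twin` —
  `F_s(φ) ≤ F_s(φ̃)` for every sector `φ` with Hermitian Lieb matrix (inequality half of (I3); Lieb's trace inequality).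
STATUS (lead c1): stub A `stub-blocked` (open problem, nothing in tree/print); stub T open and K2-hard; see the lead's NOTES.md /
LEAD-c1.md (item evidence) for the physics verdict (K2 plausible at weak coupling with `c ~ U²`; at half filling the twin of the
repulsive GS is exactly the attractive GS, so K2-type order there = planar magnetic order).

Audit (lead, 2026-08-17, farm `lean check --json`): rc 0, errors [], sorries 2 = exactly the two stub theorems;
`#print axioms TwinOnsiteCondensation_of` = [propext, Classical.choice, Quot.sound].
-/

noncomputable section

-- `Summit.<Summit>.<Problem>`: for the single-conjunct summit the duplicate component is mandated (D-0017).
set_option linter.dupNamespace false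
set_option linter.unusedVariables false

namespace Summit.HubbardSuperconductivity.HubbardSuperconductivity.Cruxes.TwinOnsiteCondensation.Birth

open scoped BigOperators Topology Manifold Classical MeasureTheory ProbabilityTheory Matrix InnerProductSpace ComplexConjugate ContinuousMap
open scoped MatrixOrder Matrix.Norms.L2Operator
open Filter Set Function TopologicalSpace MeasureTheory

open Literature.Hubbard Literature.MathematicalPhysics.QuantumLattice

/-! ## Stub statements (documentation names; the registered stubs below restate them verbatim) -/

/-- **Stub T — K2 relative to the attractive sibling (`TwinIsAttractiveLike` of the route's two-layer plan).**
At some box point `(U, δ) ∈ (0,4] × [1/10,3/10]` there are an attractive coupling `U' < 0`, a ratio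
`θ > 0` and `L₀` such that for every even `L ≥ L₀` and every normalised `(2n, 0)`-sector ground state `φ`
of the repulsive `hubbardTorus 2 L 1 U` (`n = ⌊(1-δ)L²/2⌋`) some normalised `(2n, 0)`-sector ground state
`ψ` of the attractive `hubbardTorus 2 L 1 U'` has `θ · F_s(ψ) ≤ F_s(φ̃)`, `φ̃ = liebVec n |liebW n φ|` the
twin, `F_s(χ) = Re⟨χ, (pairField sWave L)ᴴ (pairField sWave L) χ⟩`. [cite: LiebPRL1989, eq. (3)] -/
def TwinDominatesAttractive : Prop :=
  ∃ U ∈ Set.Ioc (0 : ℝ) 4, ∃ δ ∈ Set.Icc (1 / 10 : ℝ) (3 / 10), ∃ U' : ℝ, U' < 0 ∧ ∃ θ : ℝ, 0 < θ ∧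
    ∃ L₀ : ℕ, ∀ (L : ℕ) [NeZero L], L₀ ≤ L → Even L →
      ∀ φ : Fock (Orb (FermionTorus 2 L)), star φ ⬝ᵥ φ = 1 →
        IsGroundStateInSector (hubbardTorus 2 L 1 U) (2 * ⌊(1 - δ) * (L : ℝ) ^ 2 / 2⌋₊) 0 φ →
        ∃ ψ : Fock (Orb (FermionTorus 2 L)), star ψ ⬝ᵥ ψ = 1 ∧
          IsGroundStateInSector (hubbardTorus 2 L 1 U') (2 * ⌊(1 - δ) * (L : ℝ) ^ 2 / 2⌋₊) 0 ψ ∧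
          θ * (expect ((pairField sWave L)ᴴ * pairField sWave L) ψ).re ≤
            (expect ((pairField sWave L)ᴴ * pairField sWave L)
              (liebVec ⌊(1 - δ) * (L : ℝ) ^ 2 / 2⌋₊
                (CFC.abs (liebW ⌊(1 - δ) * (L : ℝ) ^ 2 / 2⌋₊ φ)))).re

/-- **Stub A — the sibling's open core (`AttractiveOnsiteLRO` of the route's two-layer plan).**
For every attractive coupling `U' < 0` and every `δ ∈ [1/10,3/10]` there are `c > 0`, `L₀` such that for
every even `L ≥ L₀` EVERY normalised `(2n, 0)`-sector ground state `ψ` of `hubbardTorus 2 L 1 U'`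
(`n = ⌊(1-δ)L²/2⌋`) has `c · L⁴ ≤ F_s(ψ) = Re⟨ψ, (pairField sWave L)ᴴ (pairField sWave L) ψ⟩`: on-site
`s`-wave pair-field LRO of the doped 2D attractive Hubbard ground state (unique up to phase and equal to
its own twin by Lieb's Theorem 1). [cite: LiebPRL1989, Theorem 1] -/
def AttractiveOnsiteLRO : Prop :=
  ∀ U' : ℝ, U' < 0 → ∀ δ ∈ Set.Icc (1 / 10 : ℝ) (3 / 10), ∃ c : ℝ, 0 < c ∧ ∃ L₀ : ℕ,
    ∀ (L : ℕ) [NeZero L], L₀ ≤ L → Even L →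
      ∀ ψ : Fock (Orb (FermionTorus 2 L)), star ψ ⬝ᵥ ψ = 1 →
        IsGroundStateInSector (hubbardTorus 2 L 1 U') (2 * ⌊(1 - δ) * (L : ℝ) ^ 2 / 2⌋₊) 0 ψ →
        c * (L : ℝ) ^ 4 ≤ (expect ((pairField sWave L)ᴴ * pairField sWave L) ψ).re

/-! ## Registered stubs (the ONLY `sorry`s of the file; signatures explicit, tree vocabulary only) -/

/-- stub T: the twin of the repulsive ground state dominates the attractive ground state's on-site order
(load-bearing, XL). Statement = `TwinDominatesAttractive`, spelled out. [cite: LiebPRL1989, eq. (3)] -/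
theorem stub_twinDominatesAttractive :
    ∃ U ∈ Set.Ioc (0 : ℝ) 4, ∃ δ ∈ Set.Icc (1 / 10 : ℝ) (3 / 10), ∃ U' : ℝ, U' < 0 ∧ ∃ θ : ℝ, 0 < θ ∧
      ∃ L₀ : ℕ, ∀ (L : ℕ) [NeZero L], L₀ ≤ L → Even L →
        ∀ φ : Fock (Orb (FermionTorus 2 L)), star φ ⬝ᵥ φ = 1 →
          IsGroundStateInSector (hubbardTorus 2 L 1 U) (2 * ⌊(1 - δ) * (L : ℝ) ^ 2 / 2⌋₊) 0 φ →
          ∃ ψ : Fock (Orb (FermionTorus 2 L)), star ψ ⬝ᵥ ψ = 1 ∧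
            IsGroundStateInSector (hubbardTorus 2 L 1 U') (2 * ⌊(1 - δ) * (L : ℝ) ^ 2 / 2⌋₊) 0 ψ ∧
            θ * (expect ((pairField sWave L)ᴴ * pairField sWave L) ψ).re ≤
              (expect ((pairField sWave L)ᴴ * pairField sWave L)
                (liebVec ⌊(1 - δ) * (L : ℝ) ^ 2 / 2⌋₊
                  (CFC.abs (liebW ⌊(1 - δ) * (L : ℝ) ^ 2 / 2⌋₊ φ)))).re := by
  sorry

/-- stub A: `s`-wave LRO of the attractive Hubbard ground state (the sibling's open problem).
Statement = `AttractiveOnsiteLRO`, spelled out. [cite: LiebPRL1989, Theorem 1] -/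
theorem stub_attractiveOnsiteLRO :
    ∀ U' : ℝ, U' < 0 → ∀ δ ∈ Set.Icc (1 / 10 : ℝ) (3 / 10), ∃ c : ℝ, 0 < c ∧ ∃ L₀ : ℕ,
      ∀ (L : ℕ) [NeZero L], L₀ ≤ L → Even L →
        ∀ ψ : Fock (Orb (FermionTorus 2 L)), star ψ ⬝ᵥ ψ = 1 →
          IsGroundStateInSector (hubbardTorus 2 L 1 U') (2 * ⌊(1 - δ) * (L : ℝ) ^ 2 / 2⌋₊) 0 ψ →
          c * (L : ℝ) ^ 4 ≤ (expect ((pairField sWave L)ᴴ * pairField sWave L) ψ).re := by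
  sorry

/-! ## Name-keyed aliases of the stub statements — the hypotheses of `TwinOnsiteCondensation_of`

The native skeleton audit admits a hypothesis of the skeleton theorem only if its head constant is a
registered obligation or is NAMED like a declared stub; `__Registered.stub_X` is the statement of `stub_X`
under that name (each alias is `rfl`-equal to its statement). -/
namespace __Registered

/-- Alias of `TwinDominatesAttractive` keyed by the registered stub name. -/
abbrev stub_twinDominatesAttractive : Prop := TwinDominatesAttractive
/-- Alias of `AttractiveOnsiteLRO` keyed by the registered stub name. -/
abbrev stub_attractiveOnsiteLRO : Prop := AttractiveOnsiteLRO

end __Registered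

/-! ## Composition: the crux BY NAME from the two stub statements (no `sorry` below) -/

/-- **TwinOnsiteCondensation_of** — sibling LRO × relative domination ⟹ K2: with `(U, δ, U', θ, L₀)` from
stub T and `(c, L₁)` from stub A at `(U', δ)`, every normalised repulsive sector ground state `φ` at an
even `L ≥ max L₀ L₁` has an attractive sector ground state `ψ` below its twin, and
`θc·L⁴ ≤ θ·F_s(ψ) ≤ F_s(φ̃)`; so K2 holds at `(U, δ)` with constant `θc`. Conclusion = the route decl, by
name. [folklore] -/
theorem TwinOnsiteCondensation_of (hT : __Registered.stub_twinDominatesAttractive)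
    (hA : __Registered.stub_attractiveOnsiteLRO) :
    Summit.HubbardSuperconductivity.HubbardSuperconductivity.Theses.LiebTwin.TwinOnsiteCondensation := by
  obtain ⟨U, hU, δ, hδ, U', hU', θ, hθ, L₀, hdom⟩ := hT
  obtain ⟨c, hc, L₁, hlro⟩ := hA U' hU' δ hδ
  refine ⟨U, hU, δ, hδ, θ * c, mul_pos hθ hc, max L₀ L₁, ?_⟩
  intro L _ hL hE φ hφ hgs
  obtain ⟨ψ, hψ, hψgs, hle⟩ := hdom L (le_of_max_le_left hL) hE φ hφ hgs
  have hfloor := hlro L (le_of_max_le_right hL) hE ψ hψ hψgs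
  calc θ * c * (L : ℝ) ^ 4 = θ * (c * (L : ℝ) ^ 4) := by ring
    _ ≤ θ * (expect ((pairField sWave L)ᴴ * pairField sWave L) ψ).re :=
        mul_le_mul_of_nonneg_left hfloor hθ.le
    _ ≤ _ := hle

/-- Wiring check (an `example`, so that `TwinOnsiteCondensation_of` stays the only theorem concluding the
crux): the registered stubs feed the skeleton theorem as stated — this term becomes the crux proof when
the two `sorry`s above are discharged. -/
example : Summit.HubbardSuperconductivity.HubbardSuperconductivity.Theses.LiebTwin.TwinOnsiteCondensation :=
  TwinOnsiteCondensation_of stub_twinDominatesAttractive stub_attractiveOnsiteLRO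

/-- The plain-arrow form `<stub sigs> → TwinOnsiteCondensation` of the skeleton theorem (same term). -/
example : TwinDominatesAttractive → AttractiveOnsiteLRO →
    Summit.HubbardSuperconductivity.HubbardSuperconductivity.Theses.LiebTwin.TwinOnsiteCondensation :=
  TwinOnsiteCondensation_of

end Summit.HubbardSuperconductivity.HubbardSuperconductivity.Cruxes.TwinOnsiteCondensation.Birth

end
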